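import Mathlib
import Summits.KontsevichZagierPeriods.KontsevichZagierPeriods.Theorems.InverseLandauTateFamilyKernelStubBoundaryFamily

/-!
# Crux `TateFamilyKernel` (stmt-KontsevichZagierPeriods-9130), line `Sketch`
# — stub `stub_boundaryFamilyLocal`

The LOCAL form of the boundary family of an exact form (`stub_boundaryFamily`, file
`InverseLandauTateFamilyKernelStubBoundaryFamily.lean`): the parameter ranges over an arbitrary
open interval `(a, b)` instead of `(0, ε)`, and no Tate condition is assumed or concluded.

Data: Griffiths data `G_k = A_k/D_k` (`k < K`) on the cube `[0,1]^{N+2}` with the parameter `ϖ`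
appended last, along coordinates `i_k`, with denominators admissible on `[0,1]^{N+2} × (a, b)`,
and such that the closed-cube integrals of the exact form `E = Σ_k ∂_{i_k} G_k` vanish for
`ϖ ∈ (a, b)`.  Conclusion: ONE family `P_b/Q_b` in `N + 1` cube variables,
`Q_b = ∏_k D_k|_{w_{i_k}=0} · D_k|_{w_{i_k}=1}` (face substitutions `aeval_snoc_faceSubst`),
admissible factorwise (`insertNth_mem_cube`), with values the summed face differences
`Σ_k (G_k|_{w_{i_k}=1} − G_k|_{w_{i_k}=0})` (`sum_faceDiff_div_prod`) and vanishing open-cube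
integrals on `(a, b)` (null faces `setIntegral_pi_Ioo_eq_setIntegral_cube'` and the divergence
theorem `stub_faceIntegral` applied to the slices `G_k(·, ϖ)`, `hasDerivAt_slice_update`).
-/

noncomputable section

open MeasureTheory Set MvPolynomial
open Literature.NumberTheory.Transcendental
open Literature.ModelTheory.ExponentialFields (IsSemialgebraic)

namespace Summit.KontsevichZagierPeriods.InverseLandau.TateFamilyKernel.Descent

/-- **The boundary family of an exact form, local form** (stub `stub_boundaryFamilyLocal` of the
crux `TateFamilyKernel`, line `Sketch`). Given Griffiths data `G_k = A_k/D_k` on `[0,1]^{N+2}`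
along coordinates `i_k` with denominators admissible on `[0,1]^{N+2} × (a, b)` (`hadm`), and the
exact form `E = Σ_k ∂_{i_k} G_k` (the displayed integrand of `hvan` is `∂_{i_k} G_k` by the
quotient rule) with vanishing closed-cube integrals for `ϖ ∈ (a, b)`, there is ONE family
`P_b/Q_b` in `N + 1` cube variables with `Q_b = ∏_k D_k|_{w_{i_k}=0} · D_k|_{w_{i_k}=1}`
admissible on `[0,1]^{N+1} × (a, b)`, whose values there are the summed face differences
`Σ_k (G_k|_{w_{i_k}=1} − G_k|_{w_{i_k}=0})`, and whose open-cube integrals vanish on `(a, b)`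
(divergence theorem `stub_faceIntegral`). [cite: KontsevichZagier2001, §1.2] -/
theorem stub_boundaryFamilyLocal (N K : ℕ) (i : Fin K → Fin (N + 2))
    (A Dn : Fin K → MvPolynomial (Fin (N + 2 + 1)) ℚ) (a b : ℝ)
    (hadm : ∀ k (w : Fin (N + 2) → ℝ) (ϖ : ℝ), (∀ t, w t ∈ Icc (0 : ℝ) 1) → ϖ ∈ Ioo a b →
      aeval (Fin.snoc w ϖ : Fin (N + 2 + 1) → ℝ) (Dn k) ≠ 0)
    (hvan : ∀ ϖ ∈ Ioo a b, ∫ w in KZ.cube (N + 2),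
      ∑ k, aeval (Fin.snoc w ϖ : Fin (N + 2 + 1) → ℝ)
          (pderiv (Fin.castSucc (i k)) (A k) * Dn k - A k * pderiv (Fin.castSucc (i k)) (Dn k)) /
        aeval (Fin.snoc w ϖ : Fin (N + 2 + 1) → ℝ) (Dn k ^ 2) = 0) :
    ∃ (Pb Qb : MvPolynomial (Fin (N + 1 + 1)) ℚ),
      (∀ (x : Fin (N + 1) → ℝ) (ϖ : ℝ), (∀ t, x t ∈ Icc (0 : ℝ) 1) → ϖ ∈ Ioo a b →
        aeval (Fin.snoc x ϖ : Fin (N + 1 + 1) → ℝ) Qb ≠ 0) ∧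
      (∀ ϖ ∈ Ioo a b, ∀ x ∈ KZ.cube (N + 1),
        aeval (Fin.snoc x ϖ : Fin (N + 1 + 1) → ℝ) Pb / aeval (Fin.snoc x ϖ : Fin (N + 1 + 1) → ℝ) Qb =
          ∑ k, (aeval (Fin.snoc (Fin.insertNth (i k) 1 x) ϖ : Fin (N + 2 + 1) → ℝ) (A k) /
                aeval (Fin.snoc (Fin.insertNth (i k) 1 x) ϖ : Fin (N + 2 + 1) → ℝ) (Dn k) -
              aeval (Fin.snoc (Fin.insertNth (i k) 0 x) ϖ : Fin (N + 2 + 1) → ℝ) (A k) /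
                aeval (Fin.snoc (Fin.insertNth (i k) 0 x) ϖ : Fin (N + 2 + 1) → ℝ) (Dn k))) ∧
      (∀ ϖ ∈ Ioo a b, ∫ x in Set.pi Set.univ (fun _ : Fin (N + 1) => Ioo (0 : ℝ) 1),
        aeval (Fin.snoc x ϖ : Fin (N + 1 + 1) → ℝ) Pb / aeval (Fin.snoc x ϖ : Fin (N + 1 + 1) → ℝ) Qb = 0) := by
  classical
  /- Step 1: face substitutions `v j c` and their evaluation. -/
  obtain ⟨v, hv⟩ : ∃ v : Fin (N + 2) → ℚ → (Fin (N + 2 + 1) → MvPolynomial (Fin (N + 1 + 1)) ℚ),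
      v = fun j c => (Fin.snoc (Fin.insertNth j (C c) (fun t : Fin (N + 1) => X (Fin.castSucc t)))
        (X (Fin.last (N + 1))) : Fin (N + 2 + 1) → MvPolynomial (Fin (N + 1 + 1)) ℚ) := ⟨_, rfl⟩
  have hev : ∀ (j : Fin (N + 2)) (c : ℚ) (P : MvPolynomial (Fin (N + 2 + 1)) ℚ)
      (x : Fin (N + 1) → ℝ) (ϖ : ℝ),
      aeval (Fin.snoc x ϖ : Fin (N + 1 + 1) → ℝ) (aeval (v j c) P) =
        aeval (Fin.snoc (Fin.insertNth j (c : ℝ) x) ϖ : Fin (N + 2 + 1) → ℝ) P := by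
    intro j c P x ϖ
    rw [hv]
    exact aeval_snoc_faceSubst j c P x ϖ
  /- Step 2: the restricted numerators and denominators. -/
  obtain ⟨D0, hD0⟩ : ∃ D0 : Fin K → MvPolynomial (Fin (N + 1 + 1)) ℚ,
      ∀ k, D0 k = aeval (v (i k) 0) (Dn k) := ⟨_, fun _ => rfl⟩
  obtain ⟨D1, hD1⟩ : ∃ D1 : Fin K → MvPolynomial (Fin (N + 1 + 1)) ℚ,
      ∀ k, D1 k = aeval (v (i k) 1) (Dn k) := ⟨_, fun _ => rfl⟩
  obtain ⟨A0, hA0⟩ : ∃ A0 : Fin K → MvPolynomial (Fin (N + 1 + 1)) ℚ,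
      ∀ k, A0 k = aeval (v (i k) 0) (A k) := ⟨_, fun _ => rfl⟩
  obtain ⟨A1, hA1⟩ : ∃ A1 : Fin K → MvPolynomial (Fin (N + 1 + 1)) ℚ,
      ∀ k, A1 k = aeval (v (i k) 1) (A k) := ⟨_, fun _ => rfl⟩
  have eD0 : ∀ (x : Fin (N + 1) → ℝ) (ϖ : ℝ) (k : Fin K),
      aeval (Fin.snoc x ϖ : Fin (N + 1 + 1) → ℝ) (D0 k) =
        aeval (Fin.snoc (Fin.insertNth (i k) 0 x) ϖ : Fin (N + 2 + 1) → ℝ) (Dn k) := by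
    intro x ϖ k
    rw [hD0, hev, Rat.cast_zero]
  have eD1 : ∀ (x : Fin (N + 1) → ℝ) (ϖ : ℝ) (k : Fin K),
      aeval (Fin.snoc x ϖ : Fin (N + 1 + 1) → ℝ) (D1 k) =
        aeval (Fin.snoc (Fin.insertNth (i k) 1 x) ϖ : Fin (N + 2 + 1) → ℝ) (Dn k) := by
    intro x ϖ k
    rw [hD1, hev, Rat.cast_one]
  have eA0 : ∀ (x : Fin (N + 1) → ℝ) (ϖ : ℝ) (k : Fin K),
      aeval (Fin.snoc x ϖ : Fin (N + 1 + 1) → ℝ) (A0 k) =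
        aeval (Fin.snoc (Fin.insertNth (i k) 0 x) ϖ : Fin (N + 2 + 1) → ℝ) (A k) := by
    intro x ϖ k
    rw [hA0, hev, Rat.cast_zero]
  have eA1 : ∀ (x : Fin (N + 1) → ℝ) (ϖ : ℝ) (k : Fin K),
      aeval (Fin.snoc x ϖ : Fin (N + 1 + 1) → ℝ) (A1 k) =
        aeval (Fin.snoc (Fin.insertNth (i k) 1 x) ϖ : Fin (N + 2 + 1) → ℝ) (A k) := by
    intro x ϖ k
    rw [hA1, hev, Rat.cast_one]
  /- Step 3: face points lie in the cube; admissibility of the restricted denominators. -/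
  have h0I : (0 : ℝ) ∈ Icc (0 : ℝ) 1 := ⟨le_rfl, zero_le_one⟩
  have h1I : (1 : ℝ) ∈ Icc (0 : ℝ) 1 := ⟨zero_le_one, le_rfl⟩
  have hDk : ∀ ϖ ∈ Ioo a b, ∀ k, ∀ w ∈ KZ.cube (N + 2),
      aeval (Fin.snoc w ϖ : Fin (N + 2 + 1) → ℝ) (Dn k) ≠ 0 :=
    fun ϖ hϖ k w hw => hadm k w ϖ (fun t => hw t) hϖ
  have hD0ne : ∀ ϖ ∈ Ioo a b, ∀ x ∈ KZ.cube (N + 1), ∀ k,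
      aeval (Fin.snoc x ϖ : Fin (N + 1 + 1) → ℝ) (D0 k) ≠ 0 := fun ϖ hϖ x hx k => by
    rw [eD0]
    exact hDk ϖ hϖ k _ (insertNth_mem_cube (i k) h0I hx)
  have hD1ne : ∀ ϖ ∈ Ioo a b, ∀ x ∈ KZ.cube (N + 1), ∀ k,
      aeval (Fin.snoc x ϖ : Fin (N + 1 + 1) → ℝ) (D1 k) ≠ 0 := fun ϖ hϖ x hx k => by
    rw [eD1]
    exact hDk ϖ hϖ k _ (insertNth_mem_cube (i k) h1I hx)
  /- Step 4: the family and its pointwise values. -/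
  have hval : ∀ ϖ ∈ Ioo a b, ∀ x ∈ KZ.cube (N + 1),
      aeval (Fin.snoc x ϖ : Fin (N + 1 + 1) → ℝ)
          (∑ k, (A1 k * D0 k - A0 k * D1 k) * ∏ k' ∈ Finset.univ.erase k, (D0 k' * D1 k')) /
        aeval (Fin.snoc x ϖ : Fin (N + 1 + 1) → ℝ) (∏ k, (D0 k * D1 k)) =
      ∑ k, (aeval (Fin.snoc (Fin.insertNth (i k) 1 x) ϖ : Fin (N + 2 + 1) → ℝ) (A k) /
            aeval (Fin.snoc (Fin.insertNth (i k) 1 x) ϖ : Fin (N + 2 + 1) → ℝ) (Dn k) -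
          aeval (Fin.snoc (Fin.insertNth (i k) 0 x) ϖ : Fin (N + 2 + 1) → ℝ) (A k) /
            aeval (Fin.snoc (Fin.insertNth (i k) 0 x) ϖ : Fin (N + 2 + 1) → ℝ) (Dn k)) := by
    intro ϖ hϖ x hx
    simp only [map_sum, map_prod, map_mul, map_sub]
    rw [sum_faceDiff_div_prod _ _ _ _ (hD0ne ϖ hϖ x hx) (hD1ne ϖ hϖ x hx)]
    simp only [eD0, eD1, eA0, eA1]
  refine ⟨∑ k, (A1 k * D0 k - A0 k * D1 k) * ∏ k' ∈ Finset.univ.erase k, (D0 k' * D1 k'),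
    ∏ k, (D0 k * D1 k), ?_, hval, ?_⟩
  · /- admissible -/
    intro x ϖ hx hϖ
    rw [map_prod]
    exact Finset.prod_ne_zero_iff.2 fun k _ => by
      rw [map_mul]
      exact mul_ne_zero (hD0ne ϖ hϖ x (fun t => hx t) k) (hD1ne ϖ hϖ x (fun t => hx t) k)
  · /- vanishing open-cube integrals -/
    intro ϖ hϖ
    obtain ⟨G, hG⟩ : ∃ G : Fin K → (Fin (N + 2) → ℝ) → ℝ, G = fun k w =>
        aeval (Fin.snoc w ϖ : Fin (N + 2 + 1) → ℝ) (A k) /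
          aeval (Fin.snoc w ϖ : Fin (N + 2 + 1) → ℝ) (Dn k) := ⟨_, rfl⟩
    obtain ⟨G', hG'⟩ : ∃ G' : Fin K → (Fin (N + 2) → ℝ) → ℝ, G' = fun k w =>
        aeval (Fin.snoc w ϖ : Fin (N + 2 + 1) → ℝ)
            (pderiv (Fin.castSucc (i k)) (A k) * Dn k - A k * pderiv (Fin.castSucc (i k)) (Dn k)) /
          aeval (Fin.snoc w ϖ : Fin (N + 2 + 1) → ℝ) (Dn k ^ 2) := ⟨_, rfl⟩
    have hGa : ∀ k ∈ (Finset.univ : Finset (Fin K)),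
        AnalyticOnNhd ℝ (G k) (KZ.cube (N + 2)) :=
      fun k _ => by
        rw [hG]
        exact analyticOnNhd_slice (A k) (Dn k) ϖ (hDk ϖ hϖ k)
    have hder : ∀ k ∈ (Finset.univ : Finset (Fin K)), ∀ w ∈ KZ.cube (N + 2),
        HasDerivAt (fun t : ℝ => G k (Function.update w (i k) t)) (G' k w) (w (i k)) :=
      fun k _ w hw => by
        rw [hG, hG']
        exact hasDerivAt_slice_update (A k) (Dn k) ϖ (i k) w (hDk ϖ hϖ k w hw)
    have hG'c : ∀ k ∈ (Finset.univ : Finset (Fin K)), ContinuousOn (G' k) (KZ.cube (N + 2)) :=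
      fun k _ => by
        rw [hG']
        exact (analyticOnNhd_slice _ (Dn k ^ 2) ϖ fun w hw => by
          rw [map_pow]; exact pow_ne_zero 2 (hDk ϖ hϖ k w hw)).continuousOn
    have hStokes := stub_faceIntegral Finset.univ i hGa hder hG'c
    have h0 : ∫ w in KZ.cube (N + 2), ∑ k, G' k w = 0 := by
      rw [hG']
      exact hvan ϖ hϖ
    have hface : ∀ k (c : ℝ), c ∈ Icc (0 : ℝ) 1 →
        IntegrableOn (fun x : Fin (N + 1) → ℝ => G k (Fin.insertNth (i k) c x))
          (KZ.cube (N + 1)) :=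
      fun k c hc => (analyticOnNhd_comp_insertNth (hGa k (Finset.mem_univ k)) (i k)
        hc).continuousOn.integrableOn_compact KZ.isCompact_cube
    have h1 : ∫ x in KZ.cube (N + 1),
        ∑ k, (G k (Fin.insertNth (i k) 1 x) - G k (Fin.insertNth (i k) 0 x)) = 0 := by
      have hsub : ∀ k, ∫ x in KZ.cube (N + 1),
          (G k (Fin.insertNth (i k) 1 x) - G k (Fin.insertNth (i k) 0 x)) =
          (∫ x in KZ.cube (N + 1), G k (Fin.insertNth (i k) 1 x)) -
            ∫ x in KZ.cube (N + 1), G k (Fin.insertNth (i k) 0 x) :=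
        fun k => integral_sub (hface k 1 h1I) (hface k 0 h0I)
      rw [integral_finsetSum]
      · simp only [hsub]
        rw [← hStokes]
        exact h0
      · intro k _
        exact (hface k 1 h1I).sub (hface k 0 h0I)
    rw [setIntegral_pi_Ioo_eq_setIntegral_cube',
      setIntegral_congr_fun KZ.measurableSet_cube (fun x hx => hval ϖ hϖ x hx)]
    simpa only [hG] using h1

end Summit.KontsevichZagierPeriods.InverseLandau.TateFamilyKernel.Descent

end
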